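/-
Copyright (c) 2026 the pub-hodgecm-mathlib formalisation cell (harness21).  Prover seat hodgecm-mathlib-K2E5-p17 (g9), Track B «K2-LIT»,
#184♮ = hLiu418 = `stmt-HodgeConjecture-24832`; socket #41, K1-b♮ ∕ (P-dec) organ — brick (dec-3b-i) «HEIGHT OF THE LINE TRANSLATE» (K1b desk K2Liu-p14 (g4)
2026-09-05T00:06Z).  THEOREMS ONLY; NO `Lines` import.
-/
import Summits.HodgeConjecture.HodgeConjecture.Theorems.K2LiuRankOneLineProjectiveHeight    -- ★ (ρ6b) `mulHeight_le_of_vecMulVec_integral` (F0P2-p09)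
import Literature.NumberTheory.Automorphic.AdelicHeightGLProofs                            -- ★ `adelicHeightGL_mul_le_const`, `adelicHeightGL_nonneg`
import Mathlib.LinearAlgebra.Projectivization.Basic
import HarnessLib

/-!
# Crux `HLiu418`, socket #41, K1-b♮ ∕ (P-dec) — brick (dec-3b-i): THE HEIGHT OF THE LINE TRANSLATE `Λ(γ[w])_𝔸 · h` IS POLYNOMIAL IN THE SUPPORT DENOMINATOR,
# THE ARCHIMEDEAN SIZE OF THE INDEX AND THE HEIGHT OF `h`

Cell `hodgecm-mathlib`, crux item hLiu418 = `stmt-HodgeConjecture-24832` (helper lane `--supports … --as helper`, count-neutral); squad K2 ∕ K2Liu, LEAD F0P6-plan (g14);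
K1b desk K2Liu-p14 (g4) (DESK WORD 00:06:17Z «(dec-3b-i) `K2LiuKindOneLineTranslateHeight`»); prover K2E5-p17 (g9).

THE LETTER.  K1-b♮'s (P-dec) head (K2Liu-p14 `K2LiuKindOneLineDecay`) turns every power of `‖Λ(γ[w])_𝔸 · h‖` in the fine decay letter into the engine's bytes
`C · ‖h‖^a · D^{a₂} · (1 + τ(S))^{N}` (`τ(S) = ‖(ι_∞ S_{ij})_{ij}‖` the TOP's archimedean size, `D ≥ 1` the support denominator with `D·S` integral — the conclusion of the TOP's
`hsuppb`).  For a RANK-ONE index `S = u ⊗ w` (`vecMulVec u w ≠ 0`) this is the composite of three ★ facts: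
* submultiplicativity of the adelic height `‖x·h‖ ≤ m‖x‖‖h‖` (★ `adelicHeightGL_mul_le_const`);
* the row-section height `‖Λ(γ[w])_𝔸‖ ≤ C₀ · H(w)^{k₀}` — ★ p863374 (ρ6a) `hΛγ_of_heightBricks`'s clause, taken here BY VALUE for ANY `Λ`, `γ` (so the consumer's own `γ` fits);
* the projective height of the line `H(w) ≤ (D·(1 + τ(S)))^{[L:ℚ]}` (★ (ρ6b) `mulHeight_le_of_vecMulVec_integral`).
HEADS.
* §1 `adelicHeightGL_mul_le_of_le_mulHeight_pow` — GENERIC: `‖x‖ ≤ C₀ H(w)^{k₀}` and `S = u ⊗ w ≠ 0`, `D·S` integral ⇒ `‖x·h‖ ≤ (m·C₀)·(D(1+τ S))^{[L:ℚ]·k₀}·‖h‖` (any `m`, any index types).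
* §2 **`adelicHeightGL_leviRow_translate_le`** — THE LETTER with explicit constants: for `Λ : GL₂(𝔸_L) → GL_m(𝔸_L)`, a section `γ` with `hΛγ : ‖Λ(γ[w])_𝔸‖ ≤ C₀ H(w)^{k₀}`,
  `‖Λ(γ[w])_𝔸 · h‖ ≤ (m·C₀) · (D·(1 + τ(u ⊗ w)))^{[L:ℚ]·k₀} · ‖h‖`; **`exists_leviRow_translate_height_le`** — the same packaged as `∃ C k k', 0 ≤ C ∧ ∀ u w … D … h, … ≤ C·(D(1+τ))^k·‖h‖^{k'}`
  over (ρ6a)'s `∃ C₀ k₀` clause (`C k k'` depend on `L` and the two bricks only; `k' = 1`), the bytes of the desk word at `m := 2 + 2`.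
References: [BorelJacquet1979] §1.2 (heights on `G(𝔸)`, submultiplicativity); [MoeglinWaldspurger1995] I.2.2, II.1.7; [BombieriGubler2006] §1.5 (projective heights).
HONEST LABEL.  Count-neutral helper: `HC_CM` is proved only modulo the 7 printed citations (2 remaining named inputs: hLiu418 = `stmt-HodgeConjecture-24832`,
h413 = `stmt-HodgeConjecture-24833`) until rung 0 closes; this file closes no socket.
-/

set_option autoImplicit false
set_option linter.dupNamespace false -- the mandated namespace repeats `HodgeConjecture.HodgeConjecture`

noncomputable section

open scoped Classical MatrixGroups
open NumberField NumberField.mixedEmbedding Height IsDedekindDomain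
open Literature.NumberTheory.Automorphic
open Summit.HodgeConjecture.HodgeConjecture.Cruxes.HLiu418.K2LiuRankOneLineProjectiveHeight (mulHeight_le_of_vecMulVec_integral)

namespace Summit.HodgeConjecture.HodgeConjecture.Cruxes.HLiu418.K2LiuKindOneLineTranslateHeight

variable (L : Type) [Field L] [NumberField L]

/-! ## §1 Generic: a height bound by a power of `H(w)` propagates to right translates, polynomially in `D·(1 + τ(S))` -/

/-- **RIGHT TRANSLATES OF AN ELEMENT OF HEIGHT `≤ C₀·H(w)^{k₀}`**: if `‖x‖ ≤ C₀ · H(w)^{k₀}` and `S = u ⊗ w ≠ 0` has `D·S` integral (`D ≥ 1`), then for every `h`,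
`‖x · h‖ ≤ (m · C₀) · (D · (1 + τ(S)))^{[L:ℚ]·k₀} · ‖h‖` with `τ(S) = ‖(ι_∞ S_{ij})_{ij}‖` (★ `adelicHeightGL_mul_le_const`, ★ (ρ6b) `mulHeight_le_of_vecMulVec_integral`).
[cite: BorelJacquet1979, §1.2] [cite: BombieriGubler2006, §1.5] -/
theorem adelicHeightGL_mul_le_of_le_mulHeight_pow {m : ℕ} {ι κ : Type*} [Fintype ι] [Fintype κ]
    (u : ι → L) (w : κ → L) (hS : Matrix.vecMulVec u w ≠ 0) {D : ℕ} (hD : 1 ≤ D) (hint : ∀ i j, IsIntegral ℤ ((D : L) * Matrix.vecMulVec u w i j))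
    (x h : GL (Fin m) (AdeleRing (𝓞 L) L)) {C₀ : ℝ} {k₀ : ℕ} (hC₀ : 0 ≤ C₀) (hx : adelicHeightGL m L x ≤ C₀ * mulHeight w ^ k₀) :
    adelicHeightGL m L (x * h) ≤
      (m * C₀) * ((D : ℝ) * (1 + ‖fun i j => mixedEmbedding L (Matrix.vecMulVec u w i j)‖)) ^ (Module.finrank ℚ L * k₀) * adelicHeightGL m L h := by
  have hh : 0 ≤ adelicHeightGL m L h := adelicHeightGL_nonneg _
  have hH : mulHeight w ^ k₀ ≤ (((D : ℝ) * (1 + ‖fun i j => mixedEmbedding L (Matrix.vecMulVec u w i j)‖)) ^ Module.finrank ℚ L) ^ k₀ :=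
    pow_le_pow_left₀ (mulHeight_pos w).le (mulHeight_le_of_vecMulVec_integral L u w hS hD hint) k₀
  calc adelicHeightGL m L (x * h) ≤ m * adelicHeightGL m L x * adelicHeightGL m L h := adelicHeightGL_mul_le_const x h
    _ ≤ m * (C₀ * mulHeight w ^ k₀) * adelicHeightGL m L h :=
        mul_le_mul_of_nonneg_right (mul_le_mul_of_nonneg_left hx (Nat.cast_nonneg m)) hh
    _ ≤ m * (C₀ * (((D : ℝ) * (1 + ‖fun i j => mixedEmbedding L (Matrix.vecMulVec u w i j)‖)) ^ Module.finrank ℚ L) ^ k₀) * adelicHeightGL m L h :=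
        mul_le_mul_of_nonneg_right (mul_le_mul_of_nonneg_left (mul_le_mul_of_nonneg_left hH hC₀) (Nat.cast_nonneg m)) hh
    _ = (m * C₀) * ((D : ℝ) * (1 + ‖fun i j => mixedEmbedding L (Matrix.vecMulVec u w i j)‖)) ^ (Module.finrank ℚ L * k₀) * adelicHeightGL m L h := by
        rw [pow_mul]; ring

/-! ## §2 The letter: the height of the line translate `Λ(γ[w])_𝔸 · h` -/

/-- **THE HEIGHT OF THE LINE TRANSLATE (explicit constants).**  For ANY map `Λ : GL₂(𝔸_L) → GL_m(𝔸_L)` and ANY section `γ : ℙ(L²) → GL₂(L)` with the row-section height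
letter `hΛγ : ‖Λ(γ[w])_𝔸‖ ≤ C₀ · H(w)^{k₀}` (★ (ρ6a) `hΛγ_of_heightBricks`'s clause), every rank-one index `S = u ⊗ w ≠ 0` (`w ≠ 0`), every support denominator `D ≥ 1` with `D·S`
integral and every `h ∈ GL_m(𝔸_L)`: `‖Λ(γ[w])_𝔸 · h‖ ≤ (m·C₀) · (D·(1 + τ(S)))^{[L:ℚ]·k₀} · ‖h‖`. [cite: BorelJacquet1979, §1.2] [cite: MoeglinWaldspurger1995, I.2.2] [cite: BombieriGubler2006, §1.5] -/
theorem adelicHeightGL_leviRow_translate_le {m : ℕ} (Λ : GL (Fin 2) (AdeleRing (𝓞 L) L) → GL (Fin m) (AdeleRing (𝓞 L) L))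
    (γ : Projectivization L (Fin 2 → L) → GL (Fin 2) L) {C₀ : ℝ} {k₀ : ℕ} (hC₀ : 0 ≤ C₀)
    (hΛγ : ∀ (w : Fin 2 → L) (hw : w ≠ 0),
      adelicHeightGL m L (Λ (Matrix.GeneralLinearGroup.map (algebraMap L (AdeleRing (𝓞 L) L)) (γ (Projectivization.mk L w hw)))) ≤ C₀ * mulHeight w ^ k₀)
    {ι : Type*} [Fintype ι] (u : ι → L) (w : Fin 2 → L) (hw : w ≠ 0) (hS : Matrix.vecMulVec u w ≠ 0)
    {D : ℕ} (hD : 1 ≤ D) (hint : ∀ i j, IsIntegral ℤ ((D : L) * Matrix.vecMulVec u w i j)) (h : GL (Fin m) (AdeleRing (𝓞 L) L)) :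
    adelicHeightGL m L (Λ (Matrix.GeneralLinearGroup.map (algebraMap L (AdeleRing (𝓞 L) L)) (γ (Projectivization.mk L w hw))) * h) ≤
      (m * C₀) * ((D : ℝ) * (1 + ‖fun i j => mixedEmbedding L (Matrix.vecMulVec u w i j)‖)) ^ (Module.finrank ℚ L * k₀) * adelicHeightGL m L h :=
  adelicHeightGL_mul_le_of_le_mulHeight_pow L u w hS hD hint _ h hC₀ (hΛγ w hw)

/-- **THE HEIGHT OF THE LINE TRANSLATE, PACKAGED** (the desk word's shape): from (ρ6a)'s clause `∃ C₀ k₀, 0 ≤ C₀ ∧ ∀ w ≠ 0, ‖Λ(γ[w])_𝔸‖ ≤ C₀·H(w)^{k₀}` for a map `Λ` and a section `γ`,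
there are `C k k'` (depending on `L` and that clause only) with `‖Λ(γ[w])_𝔸 · h‖ ≤ C · (D·(1 + τ(u ⊗ w)))^k · ‖h‖^{k'}` for every rank-one `u ⊗ w ≠ 0` in `M₂(L)`, every `D ≥ 1` with
`D·(u ⊗ w)` integral and every `h` (`C = m·C₀`, `k = [L:ℚ]·k₀`, `k' = 1`). [cite: BorelJacquet1979, §1.2] [cite: MoeglinWaldspurger1995, I.2.2, II.1.7] [cite: BombieriGubler2006, §1.5] -/
theorem exists_leviRow_translate_height_le {m : ℕ} (Λ : GL (Fin 2) (AdeleRing (𝓞 L) L) → GL (Fin m) (AdeleRing (𝓞 L) L))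
    (γ : Projectivization L (Fin 2 → L) → GL (Fin 2) L)
    (hΛγ : ∃ (C₀ : ℝ) (k₀ : ℕ), 0 ≤ C₀ ∧ ∀ (w : Fin 2 → L) (hw : w ≠ 0),
      adelicHeightGL m L (Λ (Matrix.GeneralLinearGroup.map (algebraMap L (AdeleRing (𝓞 L) L)) (γ (Projectivization.mk L w hw)))) ≤ C₀ * mulHeight w ^ k₀) :
    ∃ (C : ℝ) (k k' : ℕ), 0 ≤ C ∧ ∀ (u w : Fin 2 → L) (hw : w ≠ 0), Matrix.vecMulVec u w ≠ 0 →
      ∀ (D : ℕ), 1 ≤ D → (∀ i j, IsIntegral ℤ ((D : L) * Matrix.vecMulVec u w i j)) → ∀ h : GL (Fin m) (AdeleRing (𝓞 L) L),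
        adelicHeightGL m L (Λ (Matrix.GeneralLinearGroup.map (algebraMap L (AdeleRing (𝓞 L) L)) (γ (Projectivization.mk L w hw))) * h) ≤
          C * ((D : ℝ) * (1 + ‖fun i j => mixedEmbedding L (Matrix.vecMulVec u w i j)‖)) ^ k * adelicHeightGL m L h ^ k' := by
  obtain ⟨C₀, k₀, hC₀, hΛγ⟩ := hΛγ
  refine ⟨m * C₀, Module.finrank ℚ L * k₀, 1, by positivity, fun u w hw hS D hD hint h => ?_⟩
  rw [pow_one]
  exact adelicHeightGL_leviRow_translate_le L Λ γ hC₀ hΛγ u w hw hS hD hint h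

end Summit.HodgeConjecture.HodgeConjecture.Cruxes.HLiu418.K2LiuKindOneLineTranslateHeight

end
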